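import Literature.MathematicalPhysics.QuantumLattice.PartialParticleHole
import Literature.MathematicalPhysics.QuantumLattice.FermionQuasiFree
import HarnessLib

/-!
# The partial particle–hole transformation on quadratic operators

Topic `Literature/MathematicalPhysics/QuantumLattice` (family `hubbard`); continuation of
`PartialParticleHole.lean` (`W = partialParticleHole D`: `W c_i Wᴴ = c_i` off `D`, `= c†_i` on `D`).
Here we conjugate QUADRATIC operators, which is how the transformation is used (Lieb 1989, proof of
Thm 2; Bach–Lieb–Solovej 1994 §2: a quasi-free state with pairing becomes an ordinary one-particle
density matrix after a particle–hole transformation on part of the orbitals):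

* `partialParticleHole_conj_hop_of_not_mem` / `_of_mem`: `c†_i c_j ↦ c†_i c_j` off `D`,
  `↦ c_i c†_j = δ_{ij} − c†_j c_i` on `D`; `partialParticleHole_conj_pair`: `c_i c_j ↦ −c†_j c_i`
  for `i ∉ D`, `j ∈ D`;
* `phOneBody D A` (blocks `A|_{Dᶜ}`, `−(A|_D)ᵀ`) and **`partialParticleHole_conj_dGamma`**:
  `W dΓ(A) Wᴴ = dΓ(A^{ph}) + (Σ_{i∈D} A_{ii})·1` for `A` not mixing `D` and `Dᶜ`;
* `phPairOneBody D G` and **`partialParticleHole_conj_pairSum`**: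
  `W (Σ_{i∉D, j∈D} G_{ij} c_i c_j) Wᴴ = −dΓ(G^{ph})` — a BCS pair source becomes a number-conserving
  hopping between `Dᶜ` and `D`, so that `dΓ(A) + pairs + pairsᴴ` is unitarily equivalent to a
  number-conserving `dΓ(·) + const`, whose partition function is a determinant
  (`partitionFn_dGamma_eq_det`, `FreeFermionTraceFormula.lean`).

All statements fully proved; no named facts.

## References

* E. H. Lieb, Phys. Rev. Lett. 62 (1989) 1201, proof of Theorem 2. [Lieb1989]
* V. Bach, E. H. Lieb, J. P. Solovej, J. Stat. Phys. 76 (1994) 3, §2. [BachLiebSolovej1994]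
-/

noncomputable section

namespace Literature.MathematicalPhysics.QuantumLattice

open Matrix Finset HubbardWave0
open scoped symmDiff

variable {ι : Type*} [LinearOrder ι] [Fintype ι]

/-! ### Conjugation of quadratic operators -/

/-- `W (c†_i c_j) Wᴴ = c†_i c_j` for `i, j ∉ D`. [folklore] -/
theorem partialParticleHole_conj_hop_of_not_mem {D : Finset ι} {i j : ι} (hi : i ∉ D) (hj : j ∉ D) :
    partialParticleHole D * (creation i * annihilation j) * (partialParticleHole D)ᴴ =
      creation i * annihilation j := by
  rw [partialParticleHole_conj_mul, partialParticleHole_conj_creation_of_not_mem hi,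
    partialParticleHole_conj_annihilation_of_not_mem hj]

/-- `W (c†_i c_j) Wᴴ = c_i c†_j = δ_{ij} − c†_j c_i` for `i, j ∈ D` (mixed CAR). [folklore] -/
theorem partialParticleHole_conj_hop_of_mem {D : Finset ι} {i j : ι} (hi : i ∈ D) (hj : j ∈ D) :
    partialParticleHole D * (creation i * annihilation j) * (partialParticleHole D)ᴴ =
      (if i = j then (1 : Matrix (Finset ι) (Finset ι) ℂ) else 0) - creation j * annihilation i := by
  rw [partialParticleHole_conj_mul, partialParticleHole_conj_creation_of_mem hi,
    partialParticleHole_conj_annihilation_of_mem hj, eq_sub_iff_add_eq]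
  exact annihilation_mul_creation_add_creation_mul_annihilation_holds i j

/-- `W (c_i c_j) Wᴴ = c_i c†_j = −c†_j c_i` for `i ∉ D`, `j ∈ D` (a pair annihilator becomes a
hopping term). [cite: BachLiebSolovej1994, §2] -/
theorem partialParticleHole_conj_pair {D : Finset ι} {i j : ι} (hi : i ∉ D) (hj : j ∈ D) :
    partialParticleHole D * (annihilation i * annihilation j) * (partialParticleHole D)ᴴ =
      -(creation j * annihilation i) := by
  have hij : i ≠ j := fun h => hi (h ▸ hj)
  rw [partialParticleHole_conj_mul, partialParticleHole_conj_annihilation_of_not_mem hi,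
    partialParticleHole_conj_annihilation_of_mem hj, eq_neg_iff_add_eq_zero]
  have h := annihilation_mul_creation_add_creation_mul_annihilation_holds i j
  rwa [if_neg hij] at h

/-- Conjugation by `W` is linear: it commutes with finite sums. [folklore] -/
theorem partialParticleHole_conj_sum {α : Type*} (D : Finset ι) (s : Finset α)
    (f : α → Matrix (Finset ι) (Finset ι) ℂ) :
    partialParticleHole D * (∑ a ∈ s, f a) * (partialParticleHole D)ᴴ =
      ∑ a ∈ s, partialParticleHole D * f a * (partialParticleHole D)ᴴ := by
  rw [Finset.mul_sum, Finset.sum_mul]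

/-- Conjugation by `W` commutes with scalars. [folklore] -/
theorem partialParticleHole_conj_smul (D : Finset ι) (c : ℂ) (A : Matrix (Finset ι) (Finset ι) ℂ) :
    partialParticleHole D * (c • A) * (partialParticleHole D)ᴴ =
      c • (partialParticleHole D * A * (partialParticleHole D)ᴴ) := by
  rw [Matrix.mul_smul, Matrix.smul_mul]

/-- The one-body matrix after the partial particle–hole transformation on `D`: the `Dᶜ`-block of
`h` is kept, the `D`-block becomes `−hᵀ`, the mixed blocks are dropped:
`h^{ph}_{ij} = h_{ij}` (`i, j ∉ D`), `= −h_{ji}` (`i, j ∈ D`), `= 0` otherwise.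
[cite: BachLiebSolovej1994, §2] -/
def phOneBody (D : Finset ι) (h : Matrix ι ι ℂ) : Matrix ι ι ℂ :=
  Matrix.of fun i j => if i ∈ D then (if j ∈ D then -h j i else 0) else (if j ∈ D then 0 else h i j)

omit [Fintype ι] in
/-- Entries of `phOneBody`. [folklore] -/
theorem phOneBody_apply (D : Finset ι) (h : Matrix ι ι ℂ) (i j : ι) :
    phOneBody D h i j =
      if i ∈ D then (if j ∈ D then -h j i else 0) else (if j ∈ D then 0 else h i j) := rfl

omit [Fintype ι] in
/-- `phOneBody` of a Hermitian matrix is Hermitian. [folklore] -/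
theorem isHermitian_phOneBody (D : Finset ι) {h : Matrix ι ι ℂ} (hh : h.IsHermitian) :
    (phOneBody D h).IsHermitian := by
  refine Matrix.IsHermitian.ext fun i j => ?_
  have hij : star (h i j) = h j i := congrFun (congrFun hh j) i
  have hji : star (h j i) = h i j := congrFun (congrFun hh i) j
  simp only [phOneBody_apply]
  by_cases hi : i ∈ D <;> by_cases hj : j ∈ D <;> simp [hi, hj, hij, hji, star_neg]

/-- **Conjugation of a number-conserving quadratic Hamiltonian**: if `A` does not mix `D` with
`Dᶜ`, then `W dΓ(A) Wᴴ = dΓ(A^{ph}) + (Σ_{i ∈ D} A_{ii}) · 1` — on `D` the roles of `c` and `c†`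
are exchanged, `A_{ij} c_i c†_j = A_{ij}(δ_{ij} − c†_j c_i)`. [cite: BachLiebSolovej1994, §2] -/
theorem partialParticleHole_conj_dGamma (D : Finset ι) (A : Matrix ι ι ℂ)
    (hblock : ∀ i j, i ∈ D → j ∉ D → A i j = 0 ∧ A j i = 0) :
    partialParticleHole D * dGamma A * (partialParticleHole D)ᴴ =
      dGamma (phOneBody D A) + (∑ i ∈ D, A i i) • (1 : Matrix (Finset ι) (Finset ι) ℂ) := by
  -- termwise conjugation
  have hterm : ∀ i j, partialParticleHole D * (A i j • (creation i * annihilation j)) *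
      (partialParticleHole D)ᴴ =
      ((if i ∉ D ∧ j ∉ D then A i j • (creation i * annihilation j) else 0) -
       (if i ∈ D ∧ j ∈ D then A i j • (creation j * annihilation i) else 0)) +
      (if i ∈ D ∧ j ∈ D then A i j • (if i = j then (1 : Matrix (Finset ι) (Finset ι) ℂ) else 0)
        else 0) := by
    intro i j
    rw [partialParticleHole_conj_smul]
    by_cases hi : i ∈ D
    · by_cases hj : j ∈ D
      · have h1 : ¬ (i ∉ D ∧ j ∉ D) := fun hh => hh.1 hi
        have h2 : i ∈ D ∧ j ∈ D := ⟨hi, hj⟩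
        rw [partialParticleHole_conj_hop_of_mem hi hj, if_neg h1, if_pos h2, if_pos h2, smul_sub,
          zero_sub]
        abel
      · have h1 : ¬ (i ∉ D ∧ j ∉ D) := fun hh => hh.1 hi
        have h2 : ¬ (i ∈ D ∧ j ∈ D) := fun hh => hj hh.2
        rw [(hblock i j hi hj).1, zero_smul, if_neg h1, if_neg h2, if_neg h2]
        simp
    · by_cases hj : j ∈ D
      · have h1 : ¬ (i ∉ D ∧ j ∉ D) := fun hh => hh.2 hj
        have h2 : ¬ (i ∈ D ∧ j ∈ D) := fun hh => hi hh.1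
        rw [(hblock j i hj hi).2, zero_smul, if_neg h1, if_neg h2, if_neg h2]
        simp
      · have h1 : i ∉ D ∧ j ∉ D := ⟨hi, hj⟩
        have h2 : ¬ (i ∈ D ∧ j ∈ D) := fun hh => hi hh.1
        rw [partialParticleHole_conj_hop_of_not_mem hi hj, if_pos h1, if_neg h2, if_neg h2]
        simp
  -- the transposed `D`-block: swap the summation indices
  have hswap : ∑ i, ∑ j, (if i ∈ D ∧ j ∈ D then A i j • (creation j * annihilation i) else 0) =
      ∑ i, ∑ j, (if i ∈ D ∧ j ∈ D then A j i • (creation i * annihilation j) else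
        (0 : Matrix (Finset ι) (Finset ι) ℂ)) := by
    rw [Finset.sum_comm]
    refine Finset.sum_congr rfl fun i _ => Finset.sum_congr rfl fun j _ => ?_
    simp only [and_comm]
  -- the diagonal constants
  have hdiag : ∑ i, ∑ j, (if i ∈ D ∧ j ∈ D then
      A i j • (if i = j then (1 : Matrix (Finset ι) (Finset ι) ℂ) else 0) else 0) =
      (∑ i ∈ D, A i i) • (1 : Matrix (Finset ι) (Finset ι) ℂ) := by
    have hin : ∀ i, ∑ j, (if i ∈ D ∧ j ∈ D then
        A i j • (if i = j then (1 : Matrix (Finset ι) (Finset ι) ℂ) else 0) else 0) =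
        if i ∈ D then A i i • (1 : Matrix (Finset ι) (Finset ι) ℂ) else 0 := by
      intro i
      rw [Finset.sum_eq_single i]
      · by_cases hi : i ∈ D
        · rw [if_pos ⟨hi, hi⟩, if_pos rfl, if_pos hi]
        · rw [if_neg (fun hh => hi hh.1), if_neg hi]
      · intro j _ hji
        rw [if_neg (Ne.symm hji), smul_zero, ite_self]
      · intro hh; exact absurd (Finset.mem_univ i) hh
    simp_rw [hin]
    rw [Finset.sum_smul, ← Finset.sum_filter, Finset.filter_mem_eq_inter, Finset.univ_inter]
  -- compare with `dΓ(A^{ph})` termwise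
  have hph : ∀ i j, phOneBody D A i j • (creation i * annihilation j) =
      (if i ∉ D ∧ j ∉ D then A i j • (creation i * annihilation j) else 0) -
      (if i ∈ D ∧ j ∈ D then A j i • (creation i * annihilation j) else 0) := by
    intro i j
    rw [phOneBody_apply]
    by_cases hi : i ∈ D <;> by_cases hj : j ∈ D <;> simp [hi, hj]
  calc partialParticleHole D * dGamma A * (partialParticleHole D)ᴴ
      = ∑ i, ∑ j, partialParticleHole D * (A i j • (creation i * annihilation j)) *
          (partialParticleHole D)ᴴ := by
        rw [dGamma_eq, partialParticleHole_conj_sum]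
        exact Finset.sum_congr rfl fun i _ => partialParticleHole_conj_sum D _ _
    _ = ∑ i, ∑ j, (((if i ∉ D ∧ j ∉ D then A i j • (creation i * annihilation j) else 0) -
          (if i ∈ D ∧ j ∈ D then A i j • (creation j * annihilation i) else 0)) +
          (if i ∈ D ∧ j ∈ D then
            A i j • (if i = j then (1 : Matrix (Finset ι) (Finset ι) ℂ) else 0) else 0)) :=
        Finset.sum_congr rfl fun i _ => Finset.sum_congr rfl fun j _ => hterm i j
    _ = (∑ i, ∑ j, (if i ∉ D ∧ j ∉ D then A i j • (creation i * annihilation j) else 0)) -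
          (∑ i, ∑ j, (if i ∈ D ∧ j ∈ D then A i j • (creation j * annihilation i) else 0)) +
          ∑ i, ∑ j, (if i ∈ D ∧ j ∈ D then
            A i j • (if i = j then (1 : Matrix (Finset ι) (Finset ι) ℂ) else 0) else 0) := by
        simp only [Finset.sum_add_distrib, Finset.sum_sub_distrib]
    _ = dGamma (phOneBody D A) + (∑ i ∈ D, A i i) • (1 : Matrix (Finset ι) (Finset ι) ℂ) := by
        rw [hswap, hdiag, dGamma_eq]
        congr 1
        simp only [hph, Finset.sum_sub_distrib]

/-- The one-body matrix of the hopping term produced by a pair annihilator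
`P = Σ_{i ∉ D, j ∈ D} G_{ij} c_i c_j` under the partial particle–hole transformation:
`W P Wᴴ = −dΓ(G^{ph})`, `G^{ph}_{ji} = G_{ij}` for `j ∈ D`, `i ∉ D`, and `0` otherwise.
[cite: BachLiebSolovej1994, §2] -/
def phPairOneBody (D : Finset ι) (G : Matrix ι ι ℂ) : Matrix ι ι ℂ :=
  Matrix.of fun j i => if j ∈ D ∧ i ∉ D then G i j else 0

omit [Fintype ι] in
/-- Entries of `phPairOneBody`. [folklore] -/
theorem phPairOneBody_apply (D : Finset ι) (G : Matrix ι ι ℂ) (j i : ι) :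
    phPairOneBody D G j i = if j ∈ D ∧ i ∉ D then G i j else 0 := rfl

/-- **Conjugation of a pair annihilator**: `W (Σ_{i∉D, j∈D} G_{ij} c_i c_j) Wᴴ = −dΓ(G^{ph})` —
under the particle–hole transformation on `D` a BCS pair source becomes a particle-number
conserving hopping between `Dᶜ` and `D`. [cite: BachLiebSolovej1994, §2] -/
theorem partialParticleHole_conj_pairSum (D : Finset ι) (G : Matrix ι ι ℂ) :
    partialParticleHole D *
        (∑ i, ∑ j, if i ∉ D ∧ j ∈ D then G i j • (annihilation i * annihilation j) else 0) *
        (partialParticleHole D)ᴴ =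
      -dGamma (phPairOneBody D G) := by
  have hterm : ∀ i j, partialParticleHole D *
      (if i ∉ D ∧ j ∈ D then G i j • (annihilation i * annihilation j) else 0) *
      (partialParticleHole D)ᴴ =
      -(if i ∉ D ∧ j ∈ D then G i j • (creation j * annihilation i) else 0) := by
    intro i j
    by_cases hij : i ∉ D ∧ j ∈ D
    · rw [if_pos hij, if_pos hij, partialParticleHole_conj_smul,
        partialParticleHole_conj_pair hij.1 hij.2, smul_neg]
    · rw [if_neg hij, if_neg hij, Matrix.mul_zero, Matrix.zero_mul, neg_zero]
  calc partialParticleHole D *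
        (∑ i, ∑ j, if i ∉ D ∧ j ∈ D then G i j • (annihilation i * annihilation j) else 0) *
        (partialParticleHole D)ᴴ
      = ∑ i, ∑ j, partialParticleHole D *
          (if i ∉ D ∧ j ∈ D then G i j • (annihilation i * annihilation j) else 0) *
          (partialParticleHole D)ᴴ := by
        rw [partialParticleHole_conj_sum]
        exact Finset.sum_congr rfl fun i _ => partialParticleHole_conj_sum D _ _
    _ = ∑ i, ∑ j, -(if i ∉ D ∧ j ∈ D then G i j • (creation j * annihilation i) else 0) :=
        Finset.sum_congr rfl fun i _ => Finset.sum_congr rfl fun j _ => hterm i j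
    _ = -∑ j, ∑ i, (if i ∉ D ∧ j ∈ D then G i j • (creation j * annihilation i) else 0) := by
        simp only [Finset.sum_neg_distrib]
        rw [Finset.sum_comm]
    _ = -dGamma (phPairOneBody D G) := by
        rw [dGamma_eq]
        congr 1
        refine Finset.sum_congr rfl fun j _ => Finset.sum_congr rfl fun i _ => ?_
        rw [phPairOneBody_apply]
        by_cases hh : j ∈ D ∧ i ∉ D
        · rw [if_pos hh, if_pos ⟨hh.2, hh.1⟩]
        · rw [if_neg hh, if_neg (fun h' => hh ⟨h'.2, h'.1⟩), zero_smul]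

end Literature.MathematicalPhysics.QuantumLattice

end
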